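import Literature.Analysis.FluidPDE.FluidComputer.ThresholdLevelTableA3
import HarnessLib

/-!
# Kernel run of the A = 3 level-table checker, chunks 24 … 27 (steps 600 … 699) (bp3 gen 13, layer 4)

HONEST FRAMING: low prior, high value-of-information experiment on Tao's machine paradigm; NOT a
claim that NS blows up.

Four kernel evaluations (`decide +kernel`; no `native_decide`, no extra axioms) of the checker
`runSteps` (`ThresholdLevelCheck.lean`) on 25 steps of `ThresholdLevelTableA3.stepsT` at a time, from
the entry box `Bc i` towards the next chunk's first level, returning the entry box `Bc (i+1)`
(≈ 30 s of kernel time per chunk; same scheme as `ThresholdLevelTableRun0 … 7` for A = 2).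
-/

namespace Literature.Analysis.FluidPDE.FluidComputer

namespace ThresholdLevelTableA3

set_option maxHeartbeats 10000000 in
set_option maxRecDepth 200000 in
/-- Chunk 24 of the A = 3 table run (steps 600 … 624). [folklore] -/
theorem run24 : runSteps 60 12 3 GIt RbIt Bc24 chunk24 25497119477753100 = some Bc25 := by
  decide +kernel

set_option maxHeartbeats 10000000 in
set_option maxRecDepth 200000 in
/-- Chunk 25 of the A = 3 table run (steps 625 … 649). [folklore] -/
theorem run25 : runSteps 60 12 3 GIt RbIt Bc25 chunk25 30400773027922640 = some Bc26 := by
  decide +kernel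

set_option maxHeartbeats 10000000 in
set_option maxRecDepth 200000 in
/-- Chunk 26 of the A = 3 table run (steps 650 … 674). [folklore] -/
theorem run26 : runSteps 60 12 3 GIt RbIt Bc26 chunk26 36247506370343688 = some Bc27 := by
  decide +kernel

set_option maxHeartbeats 10000000 in
set_option maxRecDepth 200000 in
/-- Chunk 27 of the A = 3 table run (steps 675 … 699). [folklore] -/
theorem run27 : runSteps 60 12 3 GIt RbIt Bc27 chunk27 43218694368769000 = some Bc28 := by
  decide +kernel

end ThresholdLevelTableA3

end Literature.Analysis.FluidPDE.FluidComputer
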